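import Literature.Analysis.FluidPDE.NSRegFourierSolution
import Literature.Analysis.FluidPDE.NSFourierPlancherel
import Literature.Analysis.FluidPDE.NSLerayRegularised
import Literature.Analysis.FunctionSpaces.Mollification
import HarnessLib

/-!
# The Fourier multiplier of a Friedrichs mollifier

Twelfth file of the Fourier-side construction of the global regular solution of the
Leray-regularised Navier–Stokes system (discharge of
`Literature.Analysis.FluidPDE.leray_regularised_wellposed`). For a bump kernel `χ` (Mathlib
`ContDiffBump (0 : E)`, normalised kernel `θ = χ.normed volume`: smooth, compactly supported,
nonnegative, radial, unit mass) the **multiplier** `m(ξ) = 𝓕θ(ξ)` is real, even, bounded by `1` and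
rapidly decreasing — a mollifier symbol in the sense of `NSRegFourierDuhamel.IsMollifierSymbol`
(`isMollifierSymbol_msymbol`) — and the Friedrichs mollification `J_χ v = θ ⋆ v`
(`Literature.Analysis.FluidPDE.mollify`) acts on Fourier syntheses as multiplication by `m`:
`𝓕 (m · f) = θ ⋆ 𝓕 f` for `f ∈ L¹` (`fourier_msymbol_mul`, Fubini). Consequently, for the
regularised solution of `NSRegFourierSolution` built with this multiplier, the transport velocity
is the mollified velocity, `Ju(t) = J_χ u(t)` (`RegSetup.ju_eq_mollify`) — Leray's `\overline{U}`
(Leray 1934, §8 p. 206 and (5.1) p. 237; Ożański–Pooley 2018, (6.77)).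

## References

* J. Leray, Acta Math. 63 (1934), §8, Ch. V §26. [Leray1934]
* W. S. Ożański, B. C. Pooley, LMS Lecture Note Ser. 452 (2018), §1.3, (6.77). [OzanskiPooley2018]
* E. M. Stein, G. Weiss, *Introduction to Fourier Analysis on Euclidean Spaces* (1971), Ch. I §1.
-/

noncomputable section

open MeasureTheory Real Set Filter Topology Function Complex FourierTransform SchwartzMap
open scoped FourierTransform RealInnerProductSpace ENNReal ContDiff ComplexConjugate Convolution

namespace Literature.Analysis.FluidPDE.FourierNS

open ClayDatum (reVec reVec_apply)

variable {ι : Type*} [Fintype ι]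

/-! ### The kernel and its multiplier -/

/-- The normalised bump kernel as a complex-valued function, `θ(x) = χ.normed(x)`. [folklore] -/
def bumpC (χ : ContDiffBump (0 : EuclideanSpace ℝ ι)) (x : EuclideanSpace ℝ ι) : ℂ := (χ.normed volume x : ℂ)

/-- **The multiplier of the mollifier**: `m(ξ) = Re 𝓕θ(ξ)` (in fact `𝓕θ` is real,
`ofReal_msymbol`). [folklore] -/
def msymbol (χ : ContDiffBump (0 : EuclideanSpace ℝ ι)) (ξ : EuclideanSpace ℝ ι) : ℝ := (𝓕 (bumpC χ) ξ).re

variable (χ : ContDiffBump (0 : EuclideanSpace ℝ ι))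

/-- The kernel is continuous. [folklore] -/
theorem continuous_bumpC : Continuous (bumpC χ) := Complex.continuous_ofReal.comp χ.continuous_normed

/-- The kernel is smooth. [folklore] -/
theorem contDiff_bumpC : ContDiff ℝ ∞ (bumpC χ) := ofRealCLM.contDiff.comp χ.contDiff_normed

/-- The kernel has compact support. [folklore] -/
theorem hasCompactSupport_bumpC : HasCompactSupport (bumpC χ) :=
  χ.hasCompactSupport_normed.comp_left Complex.ofReal_zero

/-- The kernel is integrable. [folklore] -/
theorem integrable_bumpC : Integrable (bumpC χ) volume :=
  (continuous_bumpC χ).integrable_of_hasCompactSupport (hasCompactSupport_bumpC χ)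

/-- The kernel is even. [folklore] -/
theorem bumpC_neg (x : EuclideanSpace ℝ ι) : bumpC χ (-x) = bumpC χ x := by simp [bumpC, χ.normed_neg]

/-- The kernel has unit mass: `∫ ‖θ‖ = 1`. [folklore] -/
theorem integral_norm_bumpC : ∫ x, ‖bumpC χ x‖ = 1 := by
  have : (fun x => ‖bumpC χ x‖) = fun x => χ.normed volume x := by
    funext x; rw [bumpC, Complex.norm_real, Real.norm_of_nonneg (χ.nonneg_normed x)]
  rw [this, χ.integral_normed]

/-- The kernel is conjugation symmetric (real and even). [folklore] -/
theorem bumpC_conj_symm (x : EuclideanSpace ℝ ι) : bumpC χ (-x) = conj (bumpC χ x) := by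
  rw [bumpC_neg, bumpC, Complex.conj_ofReal]

/-- **`𝓕θ` is real**: `(m ξ : ℂ) = 𝓕θ(ξ)`. [folklore] -/
theorem ofReal_msymbol (ξ : EuclideanSpace ℝ ι) : (msymbol χ ξ : ℂ) = 𝓕 (bumpC χ) ξ :=
  (fourier_eq_re_of_conj_symm (bumpC_conj_symm χ) ξ).symm

/-- `m` is continuous. [folklore] -/
theorem continuous_msymbol : Continuous (msymbol χ) :=
  Complex.continuous_re.comp (continuous_fourierIntegral (integrable_bumpC χ))

/-- **`|m| ≤ 1`** (`‖𝓕θ‖ ≤ ∫‖θ‖ = 1`). [folklore] -/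
theorem abs_msymbol_le_one (ξ : EuclideanSpace ℝ ι) : |msymbol χ ξ| ≤ 1 := by
  have h1 : ‖𝓕 (bumpC χ) ξ‖ ≤ 1 := by
    rw [← integral_norm_bumpC χ]
    exact VectorFourier.norm_fourierIntegral_le_integral_norm _ _ _ _ _
  exact (Complex.abs_re_le_norm _).trans h1

/-- **`m` is even** (`θ` is even). [folklore] -/
theorem msymbol_neg (ξ : EuclideanSpace ℝ ι) : msymbol χ (-ξ) = msymbol χ ξ := by
  unfold msymbol
  congr 1
  rw [Real.fourier_eq, Real.fourier_eq, ← integral_neg_eq_self]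
  refine integral_congr_ae (Eventually.of_forall fun x => ?_)
  simp only [inner_neg_left, inner_neg_right, neg_neg, bumpC_neg]

/-- The kernel as a Schwartz function. [folklore] -/
def bumpSchwartz : 𝓢(EuclideanSpace ℝ ι, ℂ) := (hasCompactSupport_bumpC χ).toSchwartzMap (contDiff_bumpC χ)

/-- The Schwartz kernel is the kernel. [folklore] -/
theorem bumpSchwartz_apply (x : EuclideanSpace ℝ ι) : bumpSchwartz χ x = bumpC χ x := rfl

/-- **`m` is rapidly decreasing**: `(1 + ‖ξ‖)^K |m(ξ)| ≤ M_K` (`𝓕θ` is a Schwartz function). [folklore] -/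
theorem msymbol_decay (K : ℕ) : ∃ M : ℝ, ∀ ξ, (1 + ‖ξ‖) ^ K * |msymbol χ ξ| ≤ M := by
  set F : 𝓢(EuclideanSpace ℝ ι, ℂ) := 𝓕 (bumpSchwartz χ) with hF
  refine ⟨2 ^ K * ((Finset.Iic (K, 0)).sup fun m => SchwartzMap.seminorm ℂ m.1 m.2) F, fun ξ => ?_⟩
  have h1 := SchwartzMap.one_add_le_sup_seminorm_apply (𝕜 := ℂ) (m := (K, 0)) le_rfl le_rfl F ξ
  rw [norm_iteratedFDeriv_zero] at h1
  have hFξ : F ξ = 𝓕 (bumpC χ) ξ := by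
    rw [hF, SchwartzMap.fourier_coe]; rfl
  refine le_trans ?_ h1
  gcongr
  rw [hFξ]
  exact Complex.abs_re_le_norm _

/-- **The multiplier of a Friedrichs mollifier is a mollifier symbol.** [folklore] -/
theorem isMollifierSymbol_msymbol [DecidableEq ι] : IsMollifierSymbol (msymbol χ) where
  measurable := (continuous_msymbol χ).measurable
  abs_le_one := abs_msymbol_le_one χ
  even := msymbol_neg χ
  decay := msymbol_decay χ

/-! ### Mollification on the Fourier side -/

/-- **`𝓕 (m · f) = θ ⋆ 𝓕 f`** for `f ∈ L¹`: `𝓕 (𝓕θ · f)(x) = ∫ θ(y) 𝓕f(x − y) dy` (Fubini and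
the evenness of `θ`). [folklore] -/
theorem fourier_msymbol_mul {f : EuclideanSpace ℝ ι → ℂ} (hf : Integrable f volume) (x : EuclideanSpace ℝ ι) :
    𝓕 (fun ξ => (msymbol χ ξ : ℂ) * f ξ) x = ∫ y, bumpC χ y * 𝓕 f (x - y) := by
  simp_rw [ofReal_msymbol]
  rw [Real.fourier_eq]
  simp_rw [Real.fourier_eq, Circle.smul_def, smul_eq_mul]
  -- the double integrand
  set H : EuclideanSpace ℝ ι → EuclideanSpace ℝ ι → ℂ := fun ξ y =>
    (𝐞 (-⟪ξ, x⟫) : ℂ) * ((𝐞 (-⟪y, ξ⟫) : ℂ) * bumpC χ y) * f ξ with hH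
  have hHint : Integrable (uncurry H) ((volume : Measure (EuclideanSpace ℝ ι)).prod volume) := by
    have hb : Integrable (fun z : EuclideanSpace ℝ ι × EuclideanSpace ℝ ι => ‖f z.1‖ * ‖bumpC χ z.2‖)
        ((volume : Measure (EuclideanSpace ℝ ι)).prod volume) := hf.norm.mul_prod (integrable_bumpC χ).norm
    refine hb.mono' ?_ (Eventually.of_forall fun z => ?_)
    · have hc : Continuous fun z : EuclideanSpace ℝ ι × EuclideanSpace ℝ ι =>
          (𝐞 (-⟪z.1, x⟫) : ℂ) * (𝐞 (-⟪z.2, z.1⟫) : ℂ) := by fun_prop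
      have : uncurry H = fun z => ((𝐞 (-⟪z.1, x⟫) : ℂ) * (𝐞 (-⟪z.2, z.1⟫) : ℂ)) * (bumpC χ z.2 * f z.1) := by
        funext z; simp only [uncurry, hH]; ring
      rw [this]
      exact hc.aestronglyMeasurable.mul (((continuous_bumpC χ).aestronglyMeasurable.comp_snd).mul (hf.1.comp_fst))
    · simp only [uncurry, hH, norm_mul, Circle.norm_coe, one_mul]
      rw [mul_comm]
  have hinner : ∀ ξ, (𝐞 (-⟪ξ, x⟫) : ℂ) * ((∫ y, (𝐞 (-⟪y, ξ⟫) : ℂ) * bumpC χ y) * f ξ) = ∫ y, H ξ y := by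
    intro ξ
    rw [← integral_mul_const, ← integral_const_mul]
    refine integral_congr_ae (Eventually.of_forall fun y => ?_)
    simp only [hH]; ring
  simp_rw [hinner]
  rw [integral_integral_swap hHint]
  -- evaluate the inner integral and reflect `y ↦ -y`
  have hy : ∀ y, ∫ ξ, H ξ y = bumpC χ y * ∫ ξ, (𝐞 (-⟪ξ, x + y⟫) : ℂ) * f ξ := by
    intro y
    rw [← integral_const_mul]
    refine integral_congr_ae (Eventually.of_forall fun ξ => ?_)
    simp only [hH]
    have : (𝐞 (-⟪ξ, x⟫) : ℂ) * (𝐞 (-⟪y, ξ⟫) : ℂ) = (𝐞 (-⟪ξ, x + y⟫) : ℂ) := by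
      rw [← Circle.coe_mul, ← AddChar.map_add_eq_mul, inner_add_right, real_inner_comm ξ y]; ring_nf
    calc (𝐞 (-⟪ξ, x⟫) : ℂ) * ((𝐞 (-⟪y, ξ⟫) : ℂ) * bumpC χ y) * f ξ
        = ((𝐞 (-⟪ξ, x⟫) : ℂ) * (𝐞 (-⟪y, ξ⟫) : ℂ)) * (bumpC χ y * f ξ) := by ring
      _ = bumpC χ y * ((𝐞 (-⟪ξ, x + y⟫) : ℂ) * f ξ) := by rw [this]; ring
  simp_rw [hy]
  rw [← integral_neg_eq_self]
  refine integral_congr_ae (Eventually.of_forall fun y => ?_)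
  dsimp only
  rw [bumpC_neg, ← sub_eq_add_neg]

/-! ### The transport velocity is the mollified velocity -/

/-- Coordinates of a Friedrichs mollification: `(J_χ v)(x)_l = ∫ θ(y) v(x − y)_l dy` for locally
integrable `v`. [folklore] -/
theorem mollify_apply_coord {v : EuclideanSpace ℝ ι → EuclideanSpace ℝ ι} (hv : LocallyIntegrable v volume)
    (x : EuclideanSpace ℝ ι) (l : ι) : (mollify χ v x) l = ∫ y, χ.normed volume y * v (x - y) l := by
  have hex : ConvolutionExistsAt (χ.normed volume) v x (ContinuousLinearMap.lsmul ℝ ℝ) volume :=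
    (χ.hasCompactSupport_normed.convolutionExists_left _ χ.continuous_normed hv) x
  rw [mollify, convolution_def]
  have h := (ContinuousLinearMap.integral_comp_comm (EuclideanSpace.proj (𝕜 := ℝ) l) hex).symm
  have hp : ∀ z : EuclideanSpace ℝ ι, EuclideanSpace.proj (𝕜 := ℝ) l z = z l := fun z => rfl
  simp only [hp, ContinuousLinearMap.lsmul_apply] at h ⊢
  rw [h]
  refine integral_congr_ae (Eventually.of_forall fun y => ?_)
  rfl

variable [DecidableEq ι]

/-- **`Ju(t) = J_χ u(t)`**: for the regularised solution built with the multiplier `m = 𝓕θ` of the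
bump kernel `χ`, the transport velocity `Ju = Re 𝓕(m V)` is the Friedrichs mollification of the
velocity (Leray's `\overline{U}`; Leray 1934, §8, (5.1)). [folklore] -/
theorem RegSetup.ju_eq_mollify (d : RegSetup ι) (hm : d.m = msymbol χ) {t : ℝ} (ht : t ∈ Icc 0 d.T) :
    d.ju t = mollify χ (d.u t) := by
  have huc : Continuous (d.u t) := by
    have h := d.smooth_u.continuousOn.comp_continuous (f := fun x : EuclideanSpace ℝ ι => ((t, x) : ℝ × EuclideanSpace ℝ ι))
      (continuous_const.prodMk continuous_id) fun x => mk_mem_prod ht (mem_univ x)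
    simpa only [Function.comp_def, Function.uncurry_apply_pair] using h
  funext x
  ext l
  rw [mollify_apply_coord χ huc.locallyIntegrable x l, RegSetup.ju_apply, RegSetup.JU, hm,
    fourier_msymbol_mul χ (d.integrable_V ht l) x]
  -- real part under the integral
  have hFc : Continuous (𝓕 fun ξ => d.V t ξ l) := continuous_fourierIntegral (d.integrable_V ht l)
  have hint : Integrable (fun y => bumpC χ y * 𝓕 (fun ξ => d.V t ξ l) (x - y)) volume :=
    ((continuous_bumpC χ).mul (hFc.comp (continuous_const.sub continuous_id))).integrable_of_hasCompactSupport
      ((hasCompactSupport_bumpC χ).mul_right)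
  have h1 := integral_re hint
  simp only [RCLike.re_to_complex] at h1
  rw [← h1]
  refine integral_congr_ae (Eventually.of_forall fun y => ?_)
  show ((χ.normed volume y : ℂ) * 𝓕 (fun ξ => d.V t ξ l) (x - y)).re = χ.normed volume y * d.u t (x - y) l
  rw [Complex.re_ofReal_mul, RegSetup.u_apply, RegSetup.U]

end Literature.Analysis.FluidPDE.FourierNS

end
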